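/-
Copyright (c) 2026 the pub-hodgecm-mathlib formalisation cell (harness21).  Prover seat hodgecm-mathlib-K2E3-p14 (g2), Track B «K2-LIT» ∕ h413
(`stmt-HodgeConjecture-24833`), line `K2_E3_EllipticInputs`, unit U12, socket U12-g ‹13a› `sig_K2E3LocalIrrepAdmissible`, road A, item (B) «hcartanLevi(S)»
first rung `#(univ ∖ S) = 1` (dealer K2E3-plan (g2) 01:04:01Z, line lead K2E3-p10 (g3) RULINGS #1), part 1∕2: block bookkeeping.  2026-09-04.
-/
import Literature.NumberTheory.Automorphic.HyperspecialUnitaryParabolicBlocks        -- ★ `blockParabolic`, `loBlockGL`, `midBlockU`, `blockDiagLift`, `dualBlock`, `blockLabel`, `blockSum`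
import Literature.NumberTheory.Automorphic.UnitaryRankOneBorelModulusIndex          -- ★ `HermitianLattice.coe_inv_apply_unitary` (`g⁻¹ = J₀ σ(g)ᵀ J₀`)
import Summits.HodgeConjecture.HodgeConjecture.Theorems.K2E3LocalUnitaryWittParabolicDefs  -- ★ K2E3-p10: `wittBlockNat`, `wittBlockOn`, `wittLevi`, `wittCocharacter`
import Literature.NumberTheory.Automorphic.GLnTwoBlockLeviStructure                 -- ★ `mem_standardLeviGL_iff`
import Summits.HodgeConjecture.HodgeConjecture.Theorems.K2E3WittConeContraction     -- ★ K2E3-p10: `commute_wittCocharacter`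
import HarnessLib

/-!
# Crux `H413` — K2-LIT E3 «EllipticInputs», 13a road A, item (B) part 1∕2: THE MAXIMAL WITT LEVI `M_{univ ∖ α} = GL_c × U(J₀^{(N−2c)})` —
# block labels, the dual block, and the reconstruction `q = diag(A, g′, A†)` of a block-diagonal element of `Q_c`

Cell `hodgecm-mathlib`, Track B «K2-LIT», crux item `stmt-HodgeConjecture-24833` (h413), socket U12-g `sig_K2E3LocalIrrepAdmissible`, road A (Jacquet–Casselman
via the Witt parabolic system; ★ (F) p856336 `isAdmissible_of_leviCartan_unramified` is the driver modulo the letter `hLevi : ∀ S, hcartanLevi(S)`).  Item (B) is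
the Levi Cartan decomposition `hcartanLevi(S)`; its first rung (this seat) is the maximal Levi `S = univ.erase α`, whose group is `GL_c(K) × U(σ, J₀^{(N−2c)})(K)`,
`c = α + 1`, through the block calculus of ★ `HyperspecialUnitaryParabolicBlocks` (`Q_c = blockParabolic σ N c`, projections `loBlockGL`, `midBlockU`, lift
`blockDiagLift hσ hc A g′ = diag(A, g′, A†)`).  THIS FILE (part 1∕2, pure algebra over any field `K` with an involution `σ`):

* §1 `wittBlockNat_erase_*`, **`val_wittBlockOn_erase`**: in a standard indexing the Witt labelling of `S = univ.erase α` IS the three-block labelling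
  `blockLabel N (α+1)` of ★ `HyperspecialUnitaryParabolicBlocks`; **`mem_wittLevi_erase_iff`**: `M_{univ ∖ α}` = the block-diagonal elements.
* §2 **`apply_hiIndex_hiIndex_eq_dualBlock`**: the LAST diagonal block of any `q ∈ Q_c` is the dual `A† = J σ(A⁻¹)ᵀ J` of its first block `A = loBlockGL q`
  (from `q⁻¹ = J₀ σ(q)ᵀ J₀`, ★ `coe_inv_apply_unitary`).
* §3 **`eq_blockDiagLift`**: a block-DIAGONAL `q ∈ Q_c` IS `blockDiagLift hσ hc (loBlockGL q) (midBlockU q)`; **`eq_of_loBlockGL_eq_of_midBlockU_eq`**: two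
  block-diagonal elements of `Q_c` with the same two Levi projections are equal; **`blockDiagLift_apply_of_ne`**: the lift is block-diagonal.
* §4 **`commute_of_coe_eq_diagonal_of_blockConst`**: a diagonal element of `U(σ, J)` whose entries are constant on the blocks of a labelling commutes with every
  block-diagonal element (the centre witnesses `z` of `hcartanLevi`).
* §5 **`coe_noncommProd_wittCocharacter_pow_family`**: the matrix of `∏_i a_{f i}(ϖ)^{n i}` over any finite family `f : ι → Fin r` is diagonal (★ K2E3-p10's
  `coe_noncommProd_wittCocharacter_pow` for families; the Levi cones are indexed by `↥S`).

`--supports stmt-HodgeConjecture-24833 --as helper`.  THEOREMS ONLY — no `def`, no named fact, no instance, no notation, no `sorry`.  HONEST LABEL: HC_CM is proved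
only modulo the 7 printed citations (2 remaining named inputs: hLiu418 = stmt-HodgeConjecture-24832, h413 = stmt-HodgeConjecture-24833) until rung 0 closes;
count-neutral bookkeeping for item (B).

## References
* [BruhatTits1972] F. Bruhat, J. Tits, *Groupes réductifs sur un corps local I*, Publ. Math. IHÉS 41 (1972), (4.4.3).
* [Rogawski1990] J. D. Rogawski, *Automorphic Representations of Unitary Groups in Three Variables*, Ann. of Math. Stud. 123 (1990), §1.9–§1.10.
* [Borel1991] A. Borel, *Linear Algebraic Groups*, GTM 126 (1991), §23.
-/

set_option autoImplicit false
-- the mandated namespace repeats `HodgeConjecture.HodgeConjecture`, as in every `Theorems/*.lean` of this sub-problem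
set_option linter.dupNamespace false

noncomputable section

open scoped MatrixGroups
open Matrix

namespace Summit.HodgeConjecture.HodgeConjecture.Cruxes.H413.K2E3UnitaryBlockLeviReconstruction

open Literature.NumberTheory.Automorphic Literature.NumberTheory.Automorphic.UnitaryGroup Literature.NumberTheory.Automorphic.HermitianLattice
open K2E3LocalUnitaryWitt K2E3WittConeContraction

/-! ## §1 The Witt labelling of `S = univ.erase α` is the three-block labelling `blockLabel N (α + 1)` -/

section Labels

variable {r m : ℕ}

/-- `univ ∖ (univ.erase α) = {α}`. [folklore] -/
theorem univ_sdiff_univ_erase (α : Fin r) : (Finset.univ \ Finset.univ.erase α : Finset (Fin r)) = {α} := by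
  ext β
  simp only [Finset.mem_sdiff, Finset.mem_univ, Finset.mem_erase, ne_eq, and_true, not_not, true_and, Finset.mem_singleton]

/-- The label of `e_{i+1}` for `S = univ.erase α`: `1` past the break (`α < i`), `0` before it. [cite: Borel1991, §23] -/
theorem wittBlockNat_erase_inl (α i : Fin r) : wittBlockNat (m := m) (Finset.univ.erase α) (Sum.inl i) = if α.val < i.val then 1 else 0 := by
  change ((Finset.univ \ Finset.univ.erase α).filter fun β : Fin r => β.val < i.val).card = _
  rw [univ_sdiff_univ_erase, Finset.filter_singleton]
  split_ifs <;> rfl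

/-- The label of the middle index for `S = univ.erase α` is `1`. [cite: Borel1991, §23] -/
theorem wittBlockNat_erase_inr_inl (α : Fin r) (u : Fin m) : wittBlockNat (Finset.univ.erase α) (Sum.inr (Sum.inl u)) = 1 := by
  change (Finset.univ \ Finset.univ.erase α).card = 1
  rw [univ_sdiff_univ_erase, Finset.card_singleton]

/-- The label of the `f`-slot `j` for `S = univ.erase α`: `2` when `rev α ≤ j`, else `1`. [cite: Borel1991, §23] -/
theorem wittBlockNat_erase_inr_inr (α j : Fin r) :
    wittBlockNat (m := m) (Finset.univ.erase α) (Sum.inr (Sum.inr j)) = 1 + (if (Fin.rev α).val ≤ j.val then 1 else 0) := by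
  change (Finset.univ \ Finset.univ.erase α).card + ((Finset.univ \ Finset.univ.erase α).filter fun β : Fin r => (Fin.rev β).val ≤ j.val).card = _
  rw [univ_sdiff_univ_erase, Finset.card_singleton, Finset.filter_singleton]
  split_ifs <;> rfl

variable {N : ℕ} (e : WittIndex r m ≃ Fin N)
  (hstd : ∀ x, (e x).val = Sum.elim (fun i : Fin r => i.val) (Sum.elim (fun u : Fin m => r + u.val) (fun j : Fin r => r + m + j.val)) x)

include hstd in
/-- **In a standard indexing the Witt labelling of the maximal parabolic `S = univ.erase α` is the three-block labelling `[0, c) | [c, N−c) | [N−c, N)`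
with `c = α + 1`** of ★ `HyperspecialUnitaryParabolicBlocks` (as natural numbers). [cite: Borel1991, §23] [cite: BruhatTits1972, (4.4.3)] -/
theorem val_wittBlockOn_erase (α : Fin r) (k : Fin N) : (wittBlockOn e (Finset.univ.erase α) k).val = blockLabel N (α.val + 1) k := by
  have hN : N = r + (m + r) := by simpa using (Fintype.card_congr e).symm
  obtain ⟨x, rfl⟩ := e.surjective k
  rw [wittBlockOn_apply, e.symm_apply_apply, wittBlock_val, blockLabel]
  have hk := hstd x
  rcases x with i | u | j
  · rw [wittBlockNat_erase_inl]
    simp only [Sum.elim_inl] at hk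
    have hi := i.isLt
    have hα := α.isLt
    by_cases h : α.val < i.val
    · rw [if_pos h, if_neg (show ¬ ((e (Sum.inl i)).val < α.val + 1) by omega),
        if_pos (show (e (Sum.inl i)).val + (α.val + 1) < N by omega)]
    · rw [if_neg h, if_pos (show (e (Sum.inl i)).val < α.val + 1 by omega)]
  · rw [wittBlockNat_erase_inr_inl]
    simp only [Sum.elim_inr, Sum.elim_inl] at hk
    have hu := u.isLt
    have hα := α.isLt
    rw [if_neg (show ¬ ((e (Sum.inr (Sum.inl u))).val < α.val + 1) by omega),
      if_pos (show (e (Sum.inr (Sum.inl u))).val + (α.val + 1) < N by omega)]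
  · rw [wittBlockNat_erase_inr_inr, Fin.val_rev]
    simp only [Sum.elim_inr] at hk
    have hj := j.isLt
    have hα := α.isLt
    rw [if_neg (show ¬ ((e (Sum.inr (Sum.inr j))).val < α.val + 1) by omega)]
    by_cases h : r - (α.val + 1) ≤ j.val
    · rw [if_pos h, if_neg (show ¬ ((e (Sum.inr (Sum.inr j))).val + (α.val + 1) < N) by omega)]
    · rw [if_neg h, if_pos (show (e (Sum.inr (Sum.inr j))).val + (α.val + 1) < N by omega)]

include hstd in
/-- `2c ≤ N` for `c = α + 1`, `α < r`, in a standard indexing (`N = 2r + m`). [cite: Borel1991, §23] -/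
theorem two_mul_succ_le (α : Fin r) : 2 * (α.val + 1) ≤ N := by
  have hN : N = r + (m + r) := by simpa using (Fintype.card_congr e).symm
  have := hstd (Sum.inl α)
  have hα := α.isLt
  omega

include hstd in
/-- **Membership in the maximal Witt Levi `M_{univ ∖ α}` is block-diagonality for `blockLabel N (α+1)`** (★ `mem_wittLevi_iff`, ★ `mem_standardLeviGL_iff`,
`val_wittBlockOn_erase`). [cite: Borel1991, §23] [cite: BernsteinZelevinsky1977, §2.1] -/
theorem mem_wittLevi_erase_iff {R : Type*} [CommRing R] (σ : R →+* R) (J : Matrix (Fin N) (Fin N) R) (α : Fin r) (g : ↥(unitaryGroupOfForm σ J)) :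
    g ∈ wittLevi σ J e (Finset.univ.erase α) ↔
      ∀ i j, blockLabel N (α.val + 1) i ≠ blockLabel N (α.val + 1) j → ((g : GL (Fin N) R) : Matrix (Fin N) (Fin N) R) i j = 0 := by
  rw [mem_wittLevi_iff, mem_standardLeviGL_iff]
  refine forall_congr' fun i => forall_congr' fun j => ?_
  rw [Ne, Fin.ext_iff, val_wittBlockOn_erase e hstd, val_wittBlockOn_erase e hstd]

end Labels

/-! ## §2 The last block of `q ∈ Q_c` is the dual of its first block -/

section Dual

variable {K : Type*} [Field K] {σ : K →+* K} (hσ : ∀ x, σ (σ x) = x) {N c : ℕ} (hc : 2 * c ≤ N)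

include hσ in
/-- **`q|_{hi × hi} = (loBlockGL q)† = J σ((loBlockGL q)⁻¹)ᵀ J`** for every `q ∈ Q_c ≤ U(σ, J₀)`: the `(N−c+i, N−c+j)` entry of `q` is
`σ(((loBlockGL q)⁻¹)_{rev j, rev i})`, by `q⁻¹ = J₀ σ(q)ᵀ J₀` (★ `coe_inv_apply_unitary`) and `rev (castLE j) = hiIndex (rev j)`.
[cite: Rogawski1990, §1.9 p. 13, §1.10] -/
theorem apply_hiIndex_hiIndex_eq_dualBlock (q : ↥(blockParabolic σ N c)) (i j : Fin c) :
    (((q : unitaryGroupOfForm σ ((StdForm.antidiagonal N).over K)) : GL (Fin N) K) : Matrix (Fin N) (Fin N) K) (hiIndex hc i) (hiIndex hc j) =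
      dualBlock σ (((loBlockGL hc q)⁻¹ : GL (Fin c) K) : Matrix (Fin c) (Fin c) K) i j := by
  rw [dualBlock_apply, coe_loBlockGL_inv, loBlock_apply, ← Subgroup.coe_inv, coe_inv_apply_unitary, hσ, rev_castLE hc, rev_castLE hc, Fin.rev_rev,
    Fin.rev_rev]

end Dual

/-! ## §3 Reconstruction of a block-diagonal element of `Q_c` from its two Levi projections -/

section Reconstruction

variable {K : Type*} [Field K] {σ : K →+* K} (hσ : ∀ x, σ (σ x) = x) {N c : ℕ} (hc : 2 * c ≤ N)

/-- **A block-diagonal `q ∈ Q_c` IS the lift `diag(A, g′, A†)` of `A = loBlockGL q`, `g′ = midBlockU q`** (entry by entry over the three blocks; the last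
block by §2). [cite: Rogawski1990, §1.10] [cite: BruhatTits1972, (4.4.3)] -/
theorem eq_blockDiagLift (q : ↥(blockParabolic σ N c))
    (hq : ∀ i j, blockLabel N c i ≠ blockLabel N c j →
      (((q : unitaryGroupOfForm σ ((StdForm.antidiagonal N).over K)) : GL (Fin N) K) : Matrix (Fin N) (Fin N) K) i j = 0) :
    (q : unitaryGroupOfForm σ ((StdForm.antidiagonal N).over K)) = blockDiagLift hσ hc (loBlockGL hc q) (midBlockU hc q) := by
  refine Subtype.ext (Units.ext (Matrix.ext fun a b => ?_))
  rw [coe_blockDiagLift]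
  obtain ⟨x, rfl⟩ := (blockSum hc).surjective a
  obtain ⟨y, rfl⟩ := (blockSum hc).surjective b
  rcases x with (i | i) | i <;> rcases y with (j | j) | j <;>
    simp only [blockSum_inl_inl, blockSum_inl_inr, blockSum_inr]
  · rw [blockDiagMatrix_castLE_castLE, coe_loBlockGL, loBlock_apply]
  · rw [hq _ _ (by rw [blockLabel_castLE hc, blockLabel_midIndex hc]; decide),
      blockDiagMatrix_apply_of_ne hc _ _ _ (by rw [blockLabel_castLE hc, blockLabel_midIndex hc]; decide)]
  · rw [hq _ _ (by rw [blockLabel_castLE hc, blockLabel_hiIndex hc]; decide),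
      blockDiagMatrix_apply_of_ne hc _ _ _ (by rw [blockLabel_castLE hc, blockLabel_hiIndex hc]; decide)]
  · rw [hq _ _ (by rw [blockLabel_castLE hc, blockLabel_midIndex hc]; decide),
      blockDiagMatrix_apply_of_ne hc _ _ _ (by rw [blockLabel_castLE hc, blockLabel_midIndex hc]; decide)]
  · rw [blockDiagMatrix_midIndex_midIndex, coe_midBlockU, midBlock_apply]
  · rw [hq _ _ (by rw [blockLabel_hiIndex hc, blockLabel_midIndex hc]; decide),
      blockDiagMatrix_apply_of_ne hc _ _ _ (by rw [blockLabel_hiIndex hc, blockLabel_midIndex hc]; decide)]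
  · rw [hq _ _ (by rw [blockLabel_castLE hc, blockLabel_hiIndex hc]; decide),
      blockDiagMatrix_apply_of_ne hc _ _ _ (by rw [blockLabel_castLE hc, blockLabel_hiIndex hc]; decide)]
  · rw [hq _ _ (by rw [blockLabel_hiIndex hc, blockLabel_midIndex hc]; decide),
      blockDiagMatrix_apply_of_ne hc _ _ _ (by rw [blockLabel_hiIndex hc, blockLabel_midIndex hc]; decide)]
  · rw [blockDiagMatrix_hiIndex_hiIndex, apply_hiIndex_hiIndex_eq_dualBlock hσ hc]

/-- **The lift `diag(A, g′, A†)` is block-diagonal.** [cite: Rogawski1990, §1.10] -/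
theorem blockDiagLift_apply_of_ne (A : GL (Fin c) K) (g : unitaryGroupOfForm σ ((StdForm.antidiagonal (N - 2 * c)).over K)) {i j : Fin N}
    (hij : blockLabel N c i ≠ blockLabel N c j) :
    ((blockDiagLift hσ hc A g : GL (Fin N) K) : Matrix (Fin N) (Fin N) K) i j = 0 := by
  rw [coe_blockDiagLift]
  exact blockDiagMatrix_apply_of_ne hc _ _ _ hij

include hσ in
/-- **Two block-diagonal elements of `Q_c` with the same Levi projections `loBlockGL`, `midBlockU` are equal** (both are the lift §3).
[cite: Rogawski1990, §1.10] [cite: BruhatTits1972, (4.4.3)] -/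
theorem eq_of_loBlockGL_eq_of_midBlockU_eq (q q' : ↥(blockParabolic σ N c))
    (hq : ∀ i j, blockLabel N c i ≠ blockLabel N c j →
      (((q : unitaryGroupOfForm σ ((StdForm.antidiagonal N).over K)) : GL (Fin N) K) : Matrix (Fin N) (Fin N) K) i j = 0)
    (hq' : ∀ i j, blockLabel N c i ≠ blockLabel N c j →
      (((q' : unitaryGroupOfForm σ ((StdForm.antidiagonal N).over K)) : GL (Fin N) K) : Matrix (Fin N) (Fin N) K) i j = 0)
    (hlo : loBlockGL hc q = loBlockGL hc q') (hmid : midBlockU hc q = midBlockU hc q') :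
    (q : unitaryGroupOfForm σ ((StdForm.antidiagonal N).over K)) = q' := by
  rw [eq_blockDiagLift hσ hc q hq, eq_blockDiagLift hσ hc q' hq', hlo, hmid]

/-- Membership in `Q_c` of a block-diagonal element of `U(σ, J₀)` (block-diagonal ⇒ block upper triangular). [cite: BruhatTits1972, (4.4.3)] -/
theorem mem_blockParabolic_of_apply_eq_zero {g : unitaryGroupOfForm σ ((StdForm.antidiagonal N).over K)}
    (hg : ∀ i j, blockLabel N c i ≠ blockLabel N c j → ((g : GL (Fin N) K) : Matrix (Fin N) (Fin N) K) i j = 0) :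
    g ∈ blockParabolic σ N c :=
  fun _ _ hij => hg _ _ (ne_of_gt hij)

/-- Products of block-diagonal matrices are block-diagonal. [folklore] -/
theorem mul_apply_eq_zero_of_blockDiagonal {L : Type*} {b : Fin N → L} {X Y : Matrix (Fin N) (Fin N) K}
    (hX : ∀ i j, b i ≠ b j → X i j = 0) (hY : ∀ i j, b i ≠ b j → Y i j = 0) {i j : Fin N} (hij : b i ≠ b j) : (X * Y) i j = 0 := by
  rw [Matrix.mul_apply]
  refine Finset.sum_eq_zero fun k _ => ?_
  by_cases hik : b i = b k
  · rw [hY k j (hik ▸ hij), mul_zero]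
  · rw [hX i k hik, zero_mul]

end Reconstruction

/-! ## §4 Diagonal elements constant on the blocks commute with block-diagonal elements -/

section Centre

variable {K : Type*} [Field K] {σ : K →+* K} {N : ℕ} {L : Type*} (b : Fin N → L) {J : Matrix (Fin N) (Fin N) K}

/-- **A diagonal element `X = diag(d)` of `U(σ, J)` with `d` constant on the blocks of a labelling `b` commutes with every block-diagonal `Y ∈ U(σ, J)`**
(entrywise: `d_i Y_{ij} = Y_{ij} d_j`). The centre witnesses `z` of `hcartanLevi(S)`. [cite: Borel1991, §23] [cite: BruhatTits1972, (4.4.3)] -/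
theorem commute_of_coe_eq_diagonal_of_blockConst {X Y : unitaryGroupOfForm σ J} {d : Fin N → K}
    (hX : ((X : GL (Fin N) K) : Matrix (Fin N) (Fin N) K) = Matrix.diagonal d) (hd : ∀ i j, b i = b j → d i = d j)
    (hY : ∀ i j, b i ≠ b j → ((Y : GL (Fin N) K) : Matrix (Fin N) (Fin N) K) i j = 0) : Commute X Y := by
  refine Subtype.ext (Units.ext (Matrix.ext fun i j => ?_))
  rw [Subgroup.coe_mul, Subgroup.coe_mul, Units.val_mul, Units.val_mul, hX, Matrix.diagonal_mul, Matrix.mul_diagonal]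
  by_cases hij : b i = b j
  · rw [hd i j hij, mul_comm]
  · rw [hY i j hij, mul_zero, zero_mul]

end Centre

/-! ## §5 The matrix of a product of powers of Witt cocharacters over any index family -/

section Cone

variable {K : Type*} [Field K] (σ : K →+* K) {N r m : ℕ} (e : WittIndex r m ≃ Fin N) (Han : Matrix (Fin m) (Fin m) K)

/-- **The cone element over a family is diagonal**: for any finite index type `ι` and `f : ι → Fin r`, the matrix of `∏_i a_{f i}(ϖ)^{n i}` (product in
`U(σ, W)`, `Finset.noncommProd`) is `diagonal (k ↦ ∏_i wittCoweight_{f i}(ϖ)(e⁻¹ k)^{n i})` — ★ K2E3-p10's `coe_noncommProd_wittCocharacter_pow` verbatim for a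
family (the Levi cones are indexed by `↥S`). [cite: Borel1991, §23] -/
theorem coe_noncommProd_wittCocharacter_pow_family (hσ : ∀ a, σ (σ a) = a) (ϖ : Kˣ) {ι : Type*} [Fintype ι] (f : ι → Fin r) (n : ι → ℕ) :
    (((Finset.univ.noncommProd (fun i => wittCocharacter σ hσ e Han (f i) ϖ ^ n i)
        (fun i _ j _ _ => (commute_wittCocharacter σ e hσ Han (f i) (f j) ϖ ϖ).pow_pow (n i) (n j)) :
          ↥(unitaryGroupOfForm σ (wittFormOn e Han))) : GL (Fin N) K) : Matrix (Fin N) (Fin N) K) =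
      Matrix.diagonal fun k => ∏ i : ι, ((wittCoweight σ (f i) ϖ (e.symm k) : Kˣ) : K) ^ n i := by
  set ψ : ↥(unitaryGroupOfForm σ (wittFormOn e Han)) →* Matrix (Fin N) (Fin N) K :=
    (Units.coeHom (Matrix (Fin N) (Fin N) K)).comp (unitaryGroupOfForm σ (wittFormOn e Han)).subtype with hψ
  have hψapp : ∀ x : ↥(unitaryGroupOfForm σ (wittFormOn e Han)), ((x : GL (Fin N) K) : Matrix (Fin N) (Fin N) K) = ψ x :=
    fun x => rfl
  set v : ι → Fin N → K := fun i k => ((wittCoweight σ (f i) ϖ (e.symm k) : Kˣ) : K) ^ n i with hv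
  have hfac : ∀ i ∈ (Finset.univ : Finset ι), ψ (wittCocharacter σ hσ e Han (f i) ϖ ^ n i) = Matrix.diagonalRingHom (Fin N) K (v i) :=
    fun i _ => by
    rw [map_pow, ← hψapp, coe_wittCocharacter, coe_wittCocharacterGL, Matrix.diagonal_pow]
    rfl
  calc (((Finset.univ.noncommProd (fun i => wittCocharacter σ hσ e Han (f i) ϖ ^ n i)
        (fun i _ j _ _ => (commute_wittCocharacter σ e hσ Han (f i) (f j) ϖ ϖ).pow_pow (n i) (n j)) :
          ↥(unitaryGroupOfForm σ (wittFormOn e Han))) : GL (Fin N) K) : Matrix (Fin N) (Fin N) K)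
        = ψ (Finset.univ.noncommProd (fun i => wittCocharacter σ hσ e Han (f i) ϖ ^ n i)
            (fun i _ j _ _ => (commute_wittCocharacter σ e hσ Han (f i) (f j) ϖ ϖ).pow_pow (n i) (n j))) := rfl
    _ = Finset.univ.noncommProd (fun i => ψ (wittCocharacter σ hσ e Han (f i) ϖ ^ n i)) _ := Finset.map_noncommProd _ _ _ ψ
    _ = Finset.univ.noncommProd (fun i => Matrix.diagonalRingHom (Fin N) K (v i)) _ := Finset.noncommProd_congr rfl hfac _
    _ = Matrix.diagonalRingHom (Fin N) K (Finset.univ.noncommProd v fun _ _ _ _ _ => Commute.all _ _) :=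
        (Finset.map_noncommProd _ _ _ _).symm
    _ = Matrix.diagonalRingHom (Fin N) K (∏ i, v i) := by rw [Finset.noncommProd_eq_prod]
    _ = Matrix.diagonal fun k => ∏ i : ι, ((wittCoweight σ (f i) ϖ (e.symm k) : Kˣ) : K) ^ n i := by
        rw [Matrix.diagonalRingHom_apply]
        congr 1
        funext k
        rw [Finset.prod_apply]

end Cone

end Summit.HodgeConjecture.HodgeConjecture.Cruxes.H413.K2E3UnitaryBlockLeviReconstruction

end
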